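import Mathlib.RepresentationTheory.Homological.GroupCohomology.LowDegree
import Mathlib.LinearAlgebra.Matrix.SpecialLinearGroup
import Mathlib.FieldTheory.Finite.Basic
import Mathlib.Algebra.CharP.Lemmas
import Mathlib.Tactic.NormNum.Prime
import Literature.RepresentationTheory.AlgebraicGroups.SL2SymPower
import HarnessLib

/-!
# `H¹(SL₂(𝔽₇), Sym⁴ 𝔽₇²) ≠ 0` — the Cline–Parshall–Scott class at `p = 7`

RepresentationTheory/FiniteGroups file: definitions (`BinaryForms`, `sl2SymRep`, `sl2Sym`,
`dickson`, the explicit cocycle) and fully PROVED theorems; no named facts.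

For a prime `p ≥ 5` the first cohomology of `SL₂(𝔽_p)` with coefficients in the simple module
`L(p-3) = Sym^{p-3}(𝔽_p²)` is one-dimensional, and it is the only non-zero `H¹(SL₂(𝔽_p), L(a))`
with `0 ≤ a ≤ p - 1` (Andersen–Jørgensen–Landrock 1983; Humphreys 2006, §12.2, Proposition (b):
"`dim Ext_G(L(0), L(p-3)) = 1`", from the uniserial PIM `U(0) = [L(0); L(p-3); L(0)]`; the series
of papers of Cline–Parshall–Scott (1975–) computes such `H¹` for the minimal modules). This file
proves the instance needed by route `PSL2ArtinDoor` of the Langlands summit (item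
`BadTWPrimeKlein`: failure of the `H¹`-clause of Thorne's adequacy for images `PSL₂(𝔽₇)` at
`p = 7`, through `ad⁰ L(2) ≅ L(4) ⊕ L(2)`):

* `nontrivial_H1_sl2Sym_four_zmod_seven` — **`H¹(SL₂(𝔽₇), Sym⁴) ≠ 0`**, as `Nontrivial` of
  Mathlib's `groupCohomology.H1 (sl2Sym (ZMod 7) 4)`, where
* `sl2SymRep k n : Representation k SL(2, k) (BinaryForms k n)` is the symmetric power
  representation on binary forms of degree `n` — the substitution action `symAct` of
  `SL2SymPower.lean` (`(g · φ)(X) = φ(X g)`) restricted to Mathlib's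
  `MvPolynomial.homogeneousSubmodule (Fin 2) k n` — and `sl2Sym k n = Rep.of (sl2SymRep k n)`.

## The proof (an explicit cocycle; everything is checked by Lean, nothing is cited)

Let `D = X₀⁷X₁ - X₀X₁⁷` be the Dickson invariant (`symAct_dickson`: `g · D = det g · D = D` for
`g ∈ SL₂(𝔽_p)`, by the freshman's dream and `a^p = a`) and `e = X₀¹² - X₀⁶X₁⁶ + X₁¹²`
(degree `12 = 2p - 2`). For the elementary transvections `T = (1 1; 0 1)`, `L = (1 0; 1 1)` one
has `T · e - e = D · q_T`, `L · e - e = D · q_L` with explicit quartics `q_T`, `q_L`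
(`symAct_upper_e7`, `symAct_lower_e7`; identities of integer polynomials modulo an explicit
multiple of `7`, closed by `ring`). The set of `g` with `g · e - e ∈ D · Sym⁴` is closed under
products (`D` is invariant), contains `T^n`, `L^n`, hence is all of `SL₂(𝔽₇)` (Mathlib's
`Matrix.SL2.transvection_induction`): `exists_symAct_e7_sub_eq`. Since `𝔽₇[X₀, X₁]` is a domain,
`c(g) := (g · e - e)/D ∈ Sym⁴` is well defined and is a `1`-cocycle (`cpsCocycleFun_mul`,
`cpsCocycle`). It is not a coboundary: a coboundary `g ↦ g · m - m` evaluated at `T` vanishes at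
the `T`-fixed point `(0, 1)` of the plane, while `c(T)(0,1) = q_T(0,1) = 2 ≠ 0`
(`cpsCocycleFun_not_coboundary`). (Background, not used: `D · Sym⁴ ⊕ 𝔽₇ e ⊂ Sym¹²` is the
non-split extension of `𝔽₇` by `L(4)` complementary to the Steinberg summand of
`Sym^{2p-2} = H⁰(2p-2)`; the same `e = X₀^{2p-2} - X₀^{p-1}X₁^{p-1} + X₁^{2p-2}` works for every
`p ≥ 5`, with `q_T = ∑ (-1)^i (i+2) X₀^i X₁^{p-3-i}` — checked numerically for `p ≤ 13`, proved here
for `p = 7` only.)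

## Design notes

* `BinaryForms k n` is an `abbrev` for Mathlib's `homogeneousSubmodule`; for `k = 𝔽_p`,
  `0 ≤ n ≤ p - 1`, `sl2SymRep 𝔽_p n` is the simple module `L(n)` (Brauer–Nesbitt), in particular
  `sl2Sym (ZMod 7) 4 = L(4) = Sym⁴`.
* The group is `SL₂(𝔽₇)`, not `PSL₂(𝔽₇)`: `-1` acts trivially on quartics and `c(-1) = 0`, so the
  class descends to `PSL₂(𝔽₇) = SL₂(𝔽₇)/{±1}` (inflation is an isomorphism here since
  `H¹({±1}, Sym⁴) = 0`); the descent is left to a sequel file.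
* `Fact (Nat.Prime 7)` is a *local* instance; statements over `ZMod 7` need only `CommRing`.
* Mathlib/tree search: Mathlib has `groupCohomology.H1`, `cocycles₁`, `H1π_eq_zero_iff`,
  `Matrix.SL2.transvection_induction`, `add_pow_char`, `ZMod.pow_card`, but no symmetric power
  representation and no Dickson invariants (`lean search 'dickson|Dickson'`: only Dickson
  polynomials of the first kind in one variable, unrelated); the tree has the substitution action
  `symAct`, `symAct_mul`, `isHomogeneous_symAct`, `symAct_upper_X_*`, `symAct_lower_X_*`
  (`Literature/RepresentationTheory/AlgebraicGroups/SL2SymPower.lean`), reused here.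

## References

* J. E. Humphreys, *Modular Representations of Finite Groups of Lie Type*, LMS Lecture Note
  Series 326, CUP (2006), §12.2, Proposition (b) (`dim Ext_{SL(2,p)}(L(0), L(p-3)) = 1`, p odd)
  and §9.8 (PIMs of `SL(2, p)`). [Humphreys2005]
* H. H. Andersen, J. Jørgensen, P. Landrock, *The projective indecomposable modules of
  `SL(2, pⁿ)`*, Proc. London Math. Soc. (3) 46 (1983) 38–52. [AndersenJorgensenLandrock1983]
* E. Cline, B. Parshall, L. Scott, *Cohomology of finite groups of Lie type, I*, Publ. Math.
  IHÉS 45 (1975) 169–191. [ClineParshallScott1975]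
* J. Thorne, *On the automorphy of `l`-adic Galois representations with small residual image*,
  J. Inst. Math. Jussieu 11 (2012), Def. 2.3 (adequacy).
-/

noncomputable section

open MvPolynomial
open Literature.RepresentationTheory.AlgebraicGroups.SL2Sym

namespace Literature.RepresentationTheory.FiniteGroups

/-! ### Binary forms of degree `n` as a representation of `SL₂(k)` -/

section SymRep

variable (k : Type*) [CommRing k]

/-- The `k`-module of binary forms of degree `n`: homogeneous polynomials of degree `n` in
`k[X₀, X₁]` (Mathlib's `MvPolynomial.homogeneousSubmodule`). [folklore] -/
abbrev BinaryForms (n : ℕ) : Submodule k (MvPolynomial (Fin 2) k) :=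
  MvPolynomial.homogeneousSubmodule (Fin 2) k n

variable {k} in
/-- The substitution action `symAct g` preserves binary forms of degree `n`. [folklore] -/
theorem symAct_mem_binaryForms {n : ℕ} (g : Matrix (Fin 2) (Fin 2) k)
    {φ : MvPolynomial (Fin 2) k} (hφ : φ ∈ BinaryForms k n) : symAct g φ ∈ BinaryForms k n :=
  (mem_homogeneousSubmodule n _).2 (isHomogeneous_symAct g ((mem_homogeneousSubmodule n φ).1 hφ))

/-- **The symmetric power representation `Sym^n` of `SL₂(k)`** on binary forms of degree `n`,
`(g · φ)(X) = φ(X g)` (the substitution action `symAct` of `SL2SymPower.lean`, restricted to the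
invariant submodule of degree-`n` forms), as a Mathlib `Representation`. For `k = 𝔽_p` and
`0 ≤ n ≤ p - 1` these are the simple `𝔽_p[SL₂(𝔽_p)]`-modules `L(n)` (Brauer–Nesbitt).
[folklore] -/
def sl2SymRep (n : ℕ) : Representation k (Matrix.SpecialLinearGroup (Fin 2) k) (BinaryForms k n) where
  toFun g := (symAct (g : Matrix (Fin 2) (Fin 2) k)).toLinearMap.restrict
    fun _ hφ => symAct_mem_binaryForms (g : Matrix (Fin 2) (Fin 2) k) hφ
  map_one' := by
    refine LinearMap.ext fun φ => Subtype.ext ?_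
    simp [symAct_one]
  map_mul' g h := by
    refine LinearMap.ext fun φ => Subtype.ext ?_
    simp [symAct_mul]

/-- `Sym^n(g)` acts on a form by the substitution `symAct g`. [folklore] -/
@[simp] theorem sl2SymRep_apply_coe (n : ℕ) (g : Matrix.SpecialLinearGroup (Fin 2) k)
    (φ : BinaryForms k n) :
    ((sl2SymRep k n g φ : BinaryForms k n) : MvPolynomial (Fin 2) k) =
      symAct (g : Matrix (Fin 2) (Fin 2) k) φ := rfl

end SymRep

section Rep

universe u
variable (k : Type u) [CommRing k]

/-- `Sym^n` as an object of the category `Rep k SL₂(k)` (so that Mathlib's `groupCohomology`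
applies). [folklore] -/
abbrev sl2Sym (n : ℕ) : Rep k (Matrix.SpecialLinearGroup (Fin 2) k) := Rep.of (sl2SymRep k n)

end Rep

/-! ### Evaluation and the substitution action -/

section Eval

variable {k : Type*} [CommRing k]

/-- Evaluating `g · φ` at a point `x` is evaluating `φ` at the point `x g`
(`(x g)_i = ∑_j g_{ji} x_j`). [folklore] -/
theorem aeval_symAct (x : Fin 2 → k) (g : Matrix (Fin 2) (Fin 2) k) (φ : MvPolynomial (Fin 2) k) :
    MvPolynomial.aeval x (symAct g φ) =
      MvPolynomial.aeval (fun i => ∑ j : Fin 2, g j i * x j) φ := by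
  have h : ((MvPolynomial.aeval x).comp (symAct g) : MvPolynomial (Fin 2) k →ₐ[k] k) =
      MvPolynomial.aeval (fun i => ∑ j : Fin 2, g j i * x j) :=
    MvPolynomial.algHom_ext fun i => by simp [symAct_X]
  exact congrArg (fun F : MvPolynomial (Fin 2) k →ₐ[k] k => F φ) h

end Eval

/-! ### The Dickson invariant `X₀^p X₁ - X₀ X₁^p` -/

section Dickson

variable (p : ℕ) [hp : Fact p.Prime]

/-- The Dickson invariant `D = X₀^p X₁ - X₀ X₁^p ∈ 𝔽_p[X₀, X₁]` (L. E. Dickson 1911), the product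
of the `p + 1` linear forms over `𝔽_p` up to scalars. [folklore] -/
def dickson : MvPolynomial (Fin 2) (ZMod p) := X 0 ^ p * X 1 - X 0 * X 1 ^ p

/-- **`SL₂(𝔽_p)`-invariance of the Dickson polynomial**: `g · D = det(g) D = D`, by the
freshman's dream `(a X₀ + c X₁)^p = a X₀^p + c X₁^p` (`a^p = a` in `𝔽_p`). [folklore] -/
theorem symAct_dickson (g : Matrix.SpecialLinearGroup (Fin 2) (ZMod p)) :
    symAct (g : Matrix (Fin 2) (Fin 2) (ZMod p)) (dickson p) = dickson p := by
  set a := (g : Matrix (Fin 2) (Fin 2) (ZMod p)) 0 0 with ha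
  set b := (g : Matrix (Fin 2) (Fin 2) (ZMod p)) 0 1 with hb
  set c := (g : Matrix (Fin 2) (Fin 2) (ZMod p)) 1 0 with hc
  set d := (g : Matrix (Fin 2) (Fin 2) (ZMod p)) 1 1 with hd
  have hdet : a * d - b * c = 1 := by
    rw [ha, hb, hc, hd, ← Matrix.det_fin_two]
    exact g.det_coe
  have hC : (C a * C d - C b * C c : MvPolynomial (Fin 2) (ZMod p)) = 1 := by
    simpa only [map_sub, map_mul, map_one] using
      congrArg (C : ZMod p →+* MvPolynomial (Fin 2) (ZMod p)) hdet
  simp only [dickson, map_sub, map_mul, map_pow, symAct_X, Fin.sum_univ_two]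
  rw [← ha, ← hb, ← hc, ← hd, add_pow_char, add_pow_char]
  simp only [mul_pow, ← C_pow, ZMod.pow_card]
  linear_combination (X 0 ^ p * X 1 - X 0 * X 1 ^ p) * hC

/-- The Dickson polynomial is non-zero: its coefficient at `X₀^p X₁` is `1`. [folklore] -/
theorem dickson_ne_zero : dickson p ≠ 0 := by
  have h1 : (X 0 ^ p * X 1 : MvPolynomial (Fin 2) (ZMod p)) =
      monomial (Finsupp.single 0 p + Finsupp.single 1 1) 1 := by
    rw [← pow_one (X 1 : MvPolynomial (Fin 2) (ZMod p)), X_pow_eq_monomial, X_pow_eq_monomial,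
      monomial_mul, one_mul]
  have h2 : (X 0 * X 1 ^ p : MvPolynomial (Fin 2) (ZMod p)) =
      monomial (Finsupp.single 0 1 + Finsupp.single 1 p) 1 := by
    rw [← pow_one (X 0 : MvPolynomial (Fin 2) (ZMod p)), X_pow_eq_monomial, X_pow_eq_monomial,
      monomial_mul, one_mul]
  intro h
  have hc := congrArg (coeff (Finsupp.single 0 p + Finsupp.single 1 1)) h
  rw [dickson, h1, h2, coeff_sub, coeff_monomial, coeff_monomial, if_pos rfl, if_neg,
    coeff_zero, sub_zero] at hc
  · exact one_ne_zero hc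
  · intro h'
    have h0 := DFunLike.congr_fun h' 0
    simp only [Finsupp.add_apply, Finsupp.single_apply] at h0
    simp at h0
    exact hp.out.one_lt.ne h0

end Dickson

/-! ### The prime `7`: an explicit cocycle -/

section Seven

/-- `7` is prime (local instance for `ZMod 7` a field). [folklore] -/
local instance fact_prime_seven : Fact (Nat.Prime 7) := ⟨by norm_num⟩

/-- Local notation for the prime field `𝔽₇ = ZMod 7`. -/
local notation "𝔽₇" => ZMod 7

/-- The degree-`12 = 2p - 2` form `e = X₀¹² - X₀⁶X₁⁶ + X₁¹²`, a generator of the non-split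
extension of `𝔽₇` by `L(4)` inside `Sym¹²` (see the module docstring). [folklore] -/
def e7 : MvPolynomial (Fin 2) 𝔽₇ := X 0 ^ 12 - X 0 ^ 6 * X 1 ^ 6 + X 1 ^ 12

/-- `q_T = 6 X₀⁴ + 2 X₀³X₁ + 4 X₀²X₁² + 4 X₀X₁³ + 2 X₁⁴`: the quartic with `T · e - e = D q_T`
for `T = (1 1; 0 1)`. [folklore] -/
def qT : MvPolynomial (Fin 2) 𝔽₇ :=
  C 6 * X 0 ^ 4 + C 2 * X 0 ^ 3 * X 1 + C 4 * X 0 ^ 2 * X 1 ^ 2 + C 4 * X 0 * X 1 ^ 3 + C 2 * X 1 ^ 4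

/-- `q_L = 5 X₀⁴ + 3 X₀³X₁ + 3 X₀²X₁² + 5 X₀X₁³ + X₁⁴`: the quartic with `L · e - e = D q_L`
for `L = (1 0; 1 1)`. [folklore] -/
def qL : MvPolynomial (Fin 2) 𝔽₇ :=
  C 5 * X 0 ^ 4 + C 3 * X 0 ^ 3 * X 1 + C 3 * X 0 ^ 2 * X 1 ^ 2 + C 5 * X 0 * X 1 ^ 3 + C 1 * X 1 ^ 4

/-- `7 = 0` in `𝔽₇[X₀, X₁]`. [folklore] -/
theorem seven_eq_zero : (7 : MvPolynomial (Fin 2) 𝔽₇) = 0 := by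
  have h : ((7 : ℕ) : MvPolynomial (Fin 2) 𝔽₇) = 0 := CharP.cast_eq_zero _ 7
  exact_mod_cast h

/-- A monomial `c X₀^a X₁^b` with `a + b = n` is a binary form of degree `n`. [folklore] -/
theorem C_mul_X_pow_mul_X_pow_mem {a b n : ℕ} (c : 𝔽₇) (h : a + b = n) :
    (C c * X 0 ^ a * X 1 ^ b : MvPolynomial (Fin 2) 𝔽₇) ∈ BinaryForms 𝔽₇ n := by
  rw [mem_homogeneousSubmodule, X_pow_eq_monomial, X_pow_eq_monomial, C_mul_monomial, mul_one,
    monomial_mul, mul_one]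
  refine isHomogeneous_monomial _ ?_
  rw [map_add, Finsupp.degree_single, Finsupp.degree_single, h]

/-- `q_T` is a quartic form. [folklore] -/
theorem qT_mem : qT ∈ BinaryForms 𝔽₇ 4 := by
  unfold qT
  refine Submodule.add_mem _ (Submodule.add_mem _ (Submodule.add_mem _ (Submodule.add_mem _
    ?_ ?_) ?_) ?_) ?_
  · simpa using C_mul_X_pow_mul_X_pow_mem (a := 4) (b := 0) (n := 4) (6 : 𝔽₇) rfl
  · simpa using C_mul_X_pow_mul_X_pow_mem (a := 3) (b := 1) (n := 4) (2 : 𝔽₇) rfl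
  · exact C_mul_X_pow_mul_X_pow_mem (a := 2) (b := 2) (n := 4) (4 : 𝔽₇) rfl
  · simpa using C_mul_X_pow_mul_X_pow_mem (a := 1) (b := 3) (n := 4) (4 : 𝔽₇) rfl
  · simpa using C_mul_X_pow_mul_X_pow_mem (a := 0) (b := 4) (n := 4) (2 : 𝔽₇) rfl

/-- `q_L` is a quartic form. [folklore] -/
theorem qL_mem : qL ∈ BinaryForms 𝔽₇ 4 := by
  unfold qL
  refine Submodule.add_mem _ (Submodule.add_mem _ (Submodule.add_mem _ (Submodule.add_mem _
    ?_ ?_) ?_) ?_) ?_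
  · simpa using C_mul_X_pow_mul_X_pow_mem (a := 4) (b := 0) (n := 4) (5 : 𝔽₇) rfl
  · simpa using C_mul_X_pow_mul_X_pow_mem (a := 3) (b := 1) (n := 4) (3 : 𝔽₇) rfl
  · exact C_mul_X_pow_mul_X_pow_mem (a := 2) (b := 2) (n := 4) (3 : 𝔽₇) rfl
  · simpa using C_mul_X_pow_mul_X_pow_mem (a := 1) (b := 3) (n := 4) (5 : 𝔽₇) rfl
  · simpa using C_mul_X_pow_mul_X_pow_mem (a := 0) (b := 4) (n := 4) (1 : 𝔽₇) rfl

/-- **`T · e - e = D · q_T`** for the upper transvection `T = (1 1; 0 1)` (an identity of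
degree-`12` binary forms over `𝔽₇`, checked by `ring` over `ℤ` modulo an explicit multiple of
`7`). [folklore] -/
theorem symAct_upper_e7 : symAct !![(1 : 𝔽₇), 1; 0, 1] e7 - e7 = dickson 7 * qT := by
  have h : symAct !![(1 : 𝔽₇), 1; 0, 1] e7 - e7 - dickson 7 * qT =
      7 * (7 * X 0 ^ 10 * X 1 ^ 2 + 28 * X 0 ^ 9 * X 1 ^ 3 + 68 * X 0 ^ 8 * X 1 ^ 4 +
        112 * X 0 ^ 7 * X 1 ^ 5 + 132 * X 0 ^ 6 * X 1 ^ 6 + 114 * X 0 ^ 5 * X 1 ^ 7 +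
        71 * X 0 ^ 4 * X 1 ^ 8 + 32 * X 0 ^ 3 * X 1 ^ 9 + 10 * X 0 ^ 2 * X 1 ^ 10 +
        2 * X 0 * X 1 ^ 11) := by
    simp only [e7, qT, dickson, map_add, map_sub, map_mul, map_pow, symAct_upper_X_zero,
      symAct_upper_X_one, map_one, one_mul, map_ofNat]
    ring
  rw [← sub_eq_zero, h, seven_eq_zero, zero_mul]

/-- **`L · e - e = D · q_L`** for the lower transvection `L = (1 0; 1 1)`. [folklore] -/
theorem symAct_lower_e7 : symAct !![(1 : 𝔽₇), 0; 1, 1] e7 - e7 = dickson 7 * qL := by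
  have h : symAct !![(1 : 𝔽₇), 0; 1, 1] e7 - e7 - dickson 7 * qL =
      7 * (X 0 ^ 11 * X 1 + 9 * X 0 ^ 10 * X 1 ^ 2 + 31 * X 0 ^ 9 * X 1 ^ 3 +
        70 * X 0 ^ 8 * X 1 ^ 4 + 113 * X 0 ^ 7 * X 1 ^ 5 + 132 * X 0 ^ 6 * X 1 ^ 6 +
        113 * X 0 ^ 5 * X 1 ^ 7 + 69 * X 0 ^ 4 * X 1 ^ 8 + 29 * X 0 ^ 3 * X 1 ^ 9 +
        8 * X 0 ^ 2 * X 1 ^ 10 + X 0 * X 1 ^ 11) := by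
    simp only [e7, qL, dickson, map_add, map_sub, map_mul, map_pow, symAct_lower_X_zero,
      symAct_lower_X_one, map_one, one_mul, map_ofNat]
    ring
  rw [← sub_eq_zero, h, seven_eq_zero, zero_mul]

/-! ### Transvections generate: `g · e - e ∈ D · Sym⁴` for every `g ∈ SL₂(𝔽₇)` -/

/-- The upper elementary transvection of `SL₂` is `(1 c; 0 1)`. [folklore] -/
theorem coe_transvection_zero_one {R : Type*} [CommRing R] (h : (0 : Fin 2) ≠ 1) (c : R) :
    ((Matrix.SpecialLinearGroup.transvection h c : Matrix.SpecialLinearGroup (Fin 2) R) :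
      Matrix (Fin 2) (Fin 2) R) = !![1, c; 0, 1] := by
  rw [Matrix.SpecialLinearGroup.transvection_coe]
  ext i j
  fin_cases i <;> fin_cases j <;> simp

/-- The lower elementary transvection of `SL₂` is `(1 0; c 1)`. [folklore] -/
theorem coe_transvection_one_zero {R : Type*} [CommRing R] (h : (1 : Fin 2) ≠ 0) (c : R) :
    ((Matrix.SpecialLinearGroup.transvection h c : Matrix.SpecialLinearGroup (Fin 2) R) :
      Matrix (Fin 2) (Fin 2) R) = !![1, 0; c, 1] := by
  rw [Matrix.SpecialLinearGroup.transvection_coe]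
  ext i j
  fin_cases i <;> fin_cases j <;> simp

/-- `transvection (n) = transvection (1) ^ n`. [folklore] -/
theorem transvection_natCast {R : Type*} [CommRing R] {i j : Fin 2} (hij : i ≠ j) (n : ℕ) :
    (Matrix.SpecialLinearGroup.transvection hij (n : R) : Matrix.SpecialLinearGroup (Fin 2) R) =
      Matrix.SpecialLinearGroup.transvection hij 1 ^ n := by
  induction n with
  | zero => simp [Matrix.SpecialLinearGroup.transvection_coeff_zero]
  | succ n ih =>
    rw [pow_succ, ← ih, Nat.cast_succ]
    apply Subtype.ext
    change Matrix.transvection i j ((n : R) + 1) = Matrix.transvection i j (n : R) * Matrix.transvection i j 1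
    rw [Matrix.transvection_mul_transvection_same i j hij]

/-- The property propagated along products: `g · e - e = D q` for a quartic form `q`.
[folklore] -/
private def GoodFor (g : Matrix.SpecialLinearGroup (Fin 2) 𝔽₇) : Prop :=
  ∃ q : BinaryForms 𝔽₇ 4,
    symAct (g : Matrix (Fin 2) (Fin 2) 𝔽₇) e7 - e7 = dickson 7 * (q : MvPolynomial (Fin 2) 𝔽₇)

/-- `1` is good (`q = 0`). [folklore] -/
private theorem goodFor_one : GoodFor 1 :=
  ⟨0, by simp [symAct_one]⟩

/-- Good elements are closed under products: `q_{gh} = g · q_h + q_g` (uses `g · D = D`).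
[folklore] -/
private theorem goodFor_mul {g h : Matrix.SpecialLinearGroup (Fin 2) 𝔽₇} (hg : GoodFor g)
    (hh : GoodFor h) : GoodFor (g * h) := by
  obtain ⟨qg, hqg⟩ := hg
  obtain ⟨qh, hqh⟩ := hh
  refine ⟨sl2SymRep 𝔽₇ 4 g qh + qg, ?_⟩
  rw [Submodule.coe_add, sl2SymRep_apply_coe, Matrix.SpecialLinearGroup.coe_mul, symAct_mul,
    AlgHom.comp_apply]
  have e1 : symAct (g : Matrix (Fin 2) (Fin 2) 𝔽₇) (symAct (h : Matrix (Fin 2) (Fin 2) 𝔽₇) e7) -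
      e7 = symAct (g : Matrix (Fin 2) (Fin 2) 𝔽₇) (symAct (h : Matrix (Fin 2) (Fin 2) 𝔽₇) e7 - e7) +
        (symAct (g : Matrix (Fin 2) (Fin 2) 𝔽₇) e7 - e7) := by
    rw [map_sub]; ring
  rw [e1, hqh, hqg, map_mul, symAct_dickson]
  ring

/-- `T = (1 1; 0 1)` is good (`symAct_upper_e7`). [folklore] -/
private theorem goodFor_upper : GoodFor (Matrix.SpecialLinearGroup.transvection
    (show (0 : Fin 2) ≠ 1 by decide) (1 : 𝔽₇)) :=
  ⟨⟨qT, qT_mem⟩, by rw [coe_transvection_zero_one]; exact symAct_upper_e7⟩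

/-- `L = (1 0; 1 1)` is good (`symAct_lower_e7`). [folklore] -/
private theorem goodFor_lower : GoodFor (Matrix.SpecialLinearGroup.transvection
    (show (1 : Fin 2) ≠ 0 by decide) (1 : 𝔽₇)) :=
  ⟨⟨qL, qL_mem⟩, by rw [coe_transvection_one_zero]; exact symAct_lower_e7⟩

/-- Powers of good elements are good. [folklore] -/
private theorem goodFor_pow {g : Matrix.SpecialLinearGroup (Fin 2) 𝔽₇} (hg : GoodFor g) (n : ℕ) :
    GoodFor (g ^ n) := by
  induction n with
  | zero => simpa using goodFor_one
  | succ n ih => rw [pow_succ]; exact goodFor_mul ih hg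

/-- Every elementary transvection of `SL₂(𝔽₇)` is good (`c = n · 1`, `transvection (n) = T^n`).
[folklore] -/
private theorem goodFor_transvection (i j : Fin 2) (hij : i ≠ j) (c : 𝔽₇) :
    GoodFor (Matrix.SpecialLinearGroup.transvection hij c) := by
  obtain ⟨n, rfl⟩ : ∃ n : ℕ, (n : 𝔽₇) = c := ⟨c.val, ZMod.natCast_zmod_val c⟩
  rw [transvection_natCast]
  refine goodFor_pow ?_ n
  fin_cases i <;> fin_cases j
  · exact absurd rfl hij
  · exact goodFor_upper
  · exact goodFor_lower
  · exact absurd rfl hij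

/-- **Every `g ∈ SL₂(𝔽₇)` moves `e` inside `D · Sym⁴`:** `g · e - e = D q_g` for a (unique)
quartic form `q_g` (from the two transvections by `Matrix.SL2.transvection_induction`).
[folklore] -/
theorem exists_symAct_e7_sub_eq (g : Matrix.SpecialLinearGroup (Fin 2) 𝔽₇) :
    ∃ q : BinaryForms 𝔽₇ 4,
      symAct (g : Matrix (Fin 2) (Fin 2) 𝔽₇) e7 - e7 = dickson 7 * (q : MvPolynomial (Fin 2) 𝔽₇) :=
  Matrix.SL2.transvection_induction GoodFor goodFor_transvection (fun _ _ => goodFor_mul) g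

/-! ### The Cline–Parshall–Scott cocycle `c(g) = (g · e - e) / D` -/

/-- **The cocycle** `c : SL₂(𝔽₇) → Sym⁴`, `c(g) = (g · e - e)/D`. [folklore] -/
def cpsCocycleFun (g : Matrix.SpecialLinearGroup (Fin 2) 𝔽₇) : BinaryForms 𝔽₇ 4 :=
  (exists_symAct_e7_sub_eq g).choose

/-- The defining identity `D · c(g) = g · e - e`. [folklore] -/
theorem dickson_mul_cpsCocycleFun (g : Matrix.SpecialLinearGroup (Fin 2) 𝔽₇) :
    dickson 7 * (cpsCocycleFun g : MvPolynomial (Fin 2) 𝔽₇) =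
      symAct (g : Matrix (Fin 2) (Fin 2) 𝔽₇) e7 - e7 :=
  (exists_symAct_e7_sub_eq g).choose_spec.symm

/-- Uniqueness of the quotient by `D` (`𝔽₇[X₀, X₁]` is a domain). [folklore] -/
theorem cpsCocycleFun_eq_of_eq {g : Matrix.SpecialLinearGroup (Fin 2) 𝔽₇}
    {q : MvPolynomial (Fin 2) 𝔽₇}
    (h : symAct (g : Matrix (Fin 2) (Fin 2) 𝔽₇) e7 - e7 = dickson 7 * q) :
    (cpsCocycleFun g : MvPolynomial (Fin 2) 𝔽₇) = q :=
  mul_left_cancel₀ (dickson_ne_zero 7) (by rw [dickson_mul_cpsCocycleFun, h])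

/-- **The cocycle identity** `c(gh) = g · c(h) + c(g)`. [folklore] -/
theorem cpsCocycleFun_mul (g h : Matrix.SpecialLinearGroup (Fin 2) 𝔽₇) :
    cpsCocycleFun (g * h) = sl2SymRep 𝔽₇ 4 g (cpsCocycleFun h) + cpsCocycleFun g := by
  apply Subtype.ext
  rw [Submodule.coe_add, sl2SymRep_apply_coe]
  apply cpsCocycleFun_eq_of_eq
  have e1 : symAct ((g * h : Matrix.SpecialLinearGroup (Fin 2) 𝔽₇) : Matrix (Fin 2) (Fin 2) 𝔽₇)
      e7 - e7 = symAct (g : Matrix (Fin 2) (Fin 2) 𝔽₇)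
        (symAct (h : Matrix (Fin 2) (Fin 2) 𝔽₇) e7 - e7) +
        (symAct (g : Matrix (Fin 2) (Fin 2) 𝔽₇) e7 - e7) := by
    rw [Matrix.SpecialLinearGroup.coe_mul, symAct_mul, AlgHom.comp_apply, map_sub]
    ring
  rw [e1, ← dickson_mul_cpsCocycleFun h, ← dickson_mul_cpsCocycleFun g, map_mul,
    symAct_dickson]
  ring

/-- The cocycle as an element of Mathlib's `Z¹(SL₂(𝔽₇), Sym⁴)`. [folklore] -/
def cpsCocycle : groupCohomology.cocycles₁ (sl2Sym 𝔽₇ 4) :=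
  ⟨cpsCocycleFun, (groupCohomology.mem_cocycles₁_iff (A := sl2Sym 𝔽₇ 4) cpsCocycleFun).2
    fun g h => cpsCocycleFun_mul g h⟩

/-- Its value at `T = (1 1; 0 1)` is `q_T`. [folklore] -/
theorem cpsCocycleFun_upper :
    (cpsCocycleFun (Matrix.SpecialLinearGroup.transvection (show (0 : Fin 2) ≠ 1 by decide)
      (1 : 𝔽₇)) : MvPolynomial (Fin 2) 𝔽₇) = qT :=
  cpsCocycleFun_eq_of_eq (by rw [coe_transvection_zero_one]; exact symAct_upper_e7)

/-- `q_T` does not vanish at the `T`-fixed point `(0, 1)`: `q_T(0,1) = 2 ≠ 0`. [folklore] -/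
theorem aeval_qT : MvPolynomial.aeval ![(0 : 𝔽₇), 1] qT = 2 := by
  simp [qT]

/-- **The cocycle is not a coboundary.** A coboundary `g ↦ g · m - m` vanishes at `T` after
evaluation at the `T`-fixed point `(0, 1)` (since `(T · m)(0,1) = m((0,1) T) = m(0,1)`), whereas
`c(T)(0,1) = q_T(0,1) = 2 ≠ 0` in `𝔽₇`. [folklore] -/
theorem cpsCocycleFun_not_coboundary :
    ¬ ∃ m : BinaryForms 𝔽₇ 4, ∀ g, sl2SymRep 𝔽₇ 4 g m - m = cpsCocycleFun g := by
  rintro ⟨m, hm⟩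
  have h := congrArg (fun q : BinaryForms 𝔽₇ 4 =>
    MvPolynomial.aeval ![(0 : 𝔽₇), 1] (q : MvPolynomial (Fin 2) 𝔽₇))
    (hm (Matrix.SpecialLinearGroup.transvection (show (0 : Fin 2) ≠ 1 by decide) (1 : 𝔽₇)))
  simp only [Submodule.coe_sub, sl2SymRep_apply_coe, cpsCocycleFun_upper, aeval_qT, map_sub,
    aeval_symAct, coe_transvection_zero_one] at h
  have h0 : (fun i : Fin 2 => ∑ j : Fin 2, !![(1 : 𝔽₇), 1; 0, 1] j i * ![(0 : 𝔽₇), 1] j) =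
      ![(0 : 𝔽₇), 1] := by
    funext i
    fin_cases i <;> simp
  rw [h0, sub_self] at h
  exact absurd h (by decide)

/-- **`H¹(SL₂(𝔽₇), Sym⁴(𝔽₇²)) ≠ 0`** (Cline–Parshall–Scott; Andersen–Jørgensen–Landrock:
`H¹(SL₂(𝔽_p), L(p-3)) ≅ 𝔽_p` for `p ≥ 5`, here `p = 7`, `L(4) = Sym⁴`): the class of the
cocycle `c(g) = (g · e - e)/D`, `e = X₀¹² - X₀⁶X₁⁶ + X₁¹²`, `D` the Dickson invariant, is
non-zero. [cite: Humphreys2005, §12.2 Proposition (b)] -/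
theorem H1π_cpsCocycle_ne_zero : groupCohomology.H1π (sl2Sym 𝔽₇ 4) cpsCocycle ≠ 0 := by
  intro h0
  rw [groupCohomology.H1π_eq_zero_iff] at h0
  obtain ⟨m, hm⟩ := h0
  refine cpsCocycleFun_not_coboundary ⟨m, fun g => ?_⟩
  have hg := congrFun hm g
  change sl2SymRep 𝔽₇ 4 g m - m = cpsCocycleFun g at hg
  exact hg

/-- **`H¹(SL₂(𝔽₇), Sym⁴) ≠ 0`**, as non-triviality of Mathlib's `groupCohomology.H1` of the
representation `Sym⁴` of `SL₂(𝔽₇)` on binary quartic forms over `𝔽₇`. In particular the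
`H¹`-vanishing clause of Thorne's *adequacy* fails for subgroups of `GL₃(𝔽̄₇)` with image
`PSL₂(𝔽₇)` acting through `L(2)`, since `ad⁰ L(2) ≅ L(4) ⊕ L(2)` for `p = 7`
(Humphreys 2006, §12.2, Proposition (b): `dim Ext_{SL(2,p)}(L(0), L(p-3)) = 1` for odd `p`; here
only non-vanishing, `p = 7`). [cite: Humphreys2005, §12.2 Proposition (b)] -/
theorem nontrivial_H1_sl2Sym_four_zmod_seven :
    Nontrivial (groupCohomology.H1 (sl2Sym 𝔽₇ 4)) :=
  ⟨⟨_, 0, H1π_cpsCocycle_ne_zero⟩⟩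

end Seven

end Literature.RepresentationTheory.FiniteGroups
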